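import Mathlib
import HarnessLib
/-!
# The regime-II flux deficit of the ℓ-reduced class-E profile equation: the delay-free invariant, the strict exponent `1/3`,
# and the parameter-free leading coefficient of the approach law `C(ε) = 2/3 + κ₁ ε^{1/3} + …`

HONEST FRAMING (cell ns-blowup GROUP B «PROFILE SEARCH», zone Z6 «Elgindi-type C^{1,α} no-swirl self-similar blow-up»; human
rulings D-0035/D-0074/D-0081): elementary calculus and real algebra about the universal TRANSITION EQUATION (regime II, the axis
trench) and the DRAIN CLOSURE (regime III) of the ℓ-REDUCED ν = 0 axisymmetric NO-SWIRL **EULER** class-E profile equation in the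
limit `ε = 1/(1+δ) → 0` (profile-eng-10 g5/g6, HOME/profile/z6twin/asym/LIMIT-ANALYSIS.md §2/§4/§5 and asym/g6/TRENCH-DEFICIT.md).
A MODEL of a MODEL of a MODEL; «violates: none — MODEL (Euler)»; nothing about Navier–Stokes, nothing about existence of profiles.
Companion of `ElgindiStrainModeCoefficients` (p517447…) and `ElgindiDrainClosure` (p524093).

THE OBJECTS. In the slow variables of the trench (`σ = ln(z/m_char)`, `L = Λ/m̃` = drained `L₁₂` mass in units of the corner
speed, `τ𝒢 = g/m̃` = scaled flux, `D̂ := 3 − τ𝒢` = FLUX DEFICIT) the transition equation reads `φ′ = (1 − τ𝒢/3)/(1+2L)`,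
`L′ = τ𝒢/2`, `τ𝒢(σ) = ∫ W(θ) exp φ(σ + ½ ln sin θ) dθ` (a delay system: the bulk copies the axis history). KERNEL-CHECKED HERE:
* §1 `deficitInvariant_hasDerivAt_zero` / `deficitInvariant_const`: if the delay is neglected, i.e. `D̂′ = −D̂·g/(3(1+2L))` with the
  SAME flux `g` that drives `L′ = g/2` (any function `g`), then `J := D̂·(1+2L)^{1/3}` has derivative `0` and is constant. So the
  deficit decays with the STRICT exponent `1/3` in `L` whatever the flux history; the measured drift of `J` (from `3` at the corner
  to `J_∞ = 2.56526` numerically) is entirely the delay effect, and the «effective exponent → 1/2» caveat of LIMIT-ANALYSIS §5 is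
  withdrawn (it came from a one-step-stale print column of `transition.py`, asym/g6/TRENCH-DEFICIT.md §1).
* §2 `deficitLaw_hasDerivAt` / `deficitLaw_tendsto_D0`: the explicit family `D̂(L) = D₁(1+2L)^{−1/3}` solves `(1+2L)D̂′ = −(2/3)D̂`
  and `D̂·L^{1/3} → D₀ = D₁·2^{−1/3}` (`D₀ = 2.0360` for `D₁ = J_∞`).
* §3 `matching_singularBranch`: in plateau variables `Λ = m̃L`, `γ = μτ𝒢`, the deficit IS the singular branch `KΛ^{−1/3}` of the
  drain orbit (`ElgindiDrainClosure.drainOrbit_general`) with `K = −μD₁(m̃/2)^{1/3}` — the two «1/3»'s are the same number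
  (the local-flux coefficient `1/2 − α/3 → 1/3`).
* §4 `massCondition_iff_quartic`: with the singular branch kept, the mass condition `γ(1/2) = 0`, `μ = 2C − 1`, written in the
  cube-root variable `v = μ^{1/3}` and `a := D₀(2ε)^{1/3}`, is the QUARTIC `9v³ − 3 = 4a v⁴` (`singularBranch_at_half` is the
  `rpow` dictionary `KΛ^{−1/3}|_{Λ=1/2} = −D₀(2ε)^{1/3}μ^{1/3}μ`).
* §5 `quartic_strictMonoOn` / `quartic_root_unique` / `quartic_root_exists` / `quartic_root_bounds` / `quartic_root_tendsto`: for `0 ≤ a < 9/8` the quartic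
  has exactly one root in `[0,1]`, it lies in `[v₀, 1]`, `v₀ = (1/3)^{1/3}`, and `μ − 1/3 = v³ − 1/3` is squeezed between
  `4av₀/27` and `(4a/3)/(27v₀² − 16a)`; hence `(C − 2/3)/a → 2v₀/27 = 3^{−4/3}/4.5` as `a → 0⁺`: the LEADING coefficient of the
  approach law is `κ₁ = (2/27)(2/3)^{1/3}D₀` — parameter-free once `D₀` is read off the universal transition solution;
  `kappa1_bracket`: `D₀ ∈ [2.0360, 2.0361] ⇒ κ₁ ∈ (0.1317, 0.1318)` (reduced-model table: `(C − 2/3)/ε^{1/3} = 0.1323` at `ε = 1e-5`,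
  approaching from above).
WHAT IS NOT PROVED: the transition equation and the drain closure themselves (modelling steps resting on the reduced equation), the
value `J_∞` (float64 numerics, asym/g6), the next-order coefficient, anything about the full class-E system. PLACEMENT: cell-own
MODEL lemma next to `ElgindiDrainClosure` (profile-eng-10); bears on LADDER-NS N5 / zone Z6 case Z6-1 (c) «death mechanism»
(P-Z6-11 DESCRIPTIVE footnote, RULING (ij)(2)) → N1 linear core.
-/

open Real Filter Topology

namespace Summit.NavierStokesRegularity.OSWSelfSimilar
namespace ElgindiTrenchDeficit

/-! ## §1 The delay-free invariant `J = D̂ (1+2L)^{1/3}` -/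

/-- **Delay-free deficit invariant.** If the deficit and the drained mass are driven by the same flux `g`,
`D̂′ = −D̂·g/(3(1+2L))` and `L′ = g/2` with `1 + 2L > 0`, then `J = D̂·(1+2L)^{1/3}` has derivative `0` — for ANY value of the
flux. [new here — MODEL calculus; asym/g6/TRENCH-DEFICIT.md §2] -/
theorem deficitInvariant_hasDerivAt_zero {D L g : ℝ → ℝ} {D' L' σ : ℝ}
    (hD : HasDerivAt D D' σ) (hL : HasDerivAt L L' σ) (hpos : 0 < 1 + 2 * L σ)
    (hDeq : D' = -(D σ * g σ) / (3 * (1 + 2 * L σ))) (hLeq : L' = g σ / 2) :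
    HasDerivAt (fun s => D s * (1 + 2 * L s) ^ (1 / 3 : ℝ)) 0 σ := by
  have h1 : HasDerivAt (fun s => 1 + 2 * L s) (2 * L') σ := by
    have := (hL.const_mul 2).const_add 1
    simpa using this
  have h2 : HasDerivAt (fun s => (1 + 2 * L s) ^ (1 / 3 : ℝ))
      (2 * L' * (1 / 3 : ℝ) * (1 + 2 * L σ) ^ ((1 / 3 : ℝ) - 1)) σ :=
    h1.rpow_const (Or.inl hpos.ne')
  refine (hD.fun_mul h2).congr_deriv ?_
  rw [Real.rpow_sub_one hpos.ne', hDeq, hLeq]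
  field_simp
  ring

/-- **Constancy of the invariant.** Under the delay-free law on all of `ℝ`, `D̂(a)(1+2L(a))^{1/3} = D̂(b)(1+2L(b))^{1/3}` for all
`a, b`: the deficit decays EXACTLY like `(1+2L)^{−1/3}` — strict exponent `1/3`, independent of the flux history.
[new here — MODEL calculus; asym/g6/TRENCH-DEFICIT.md §2] -/
theorem deficitInvariant_const {D L g : ℝ → ℝ}
    (hD : ∀ s, HasDerivAt D (-(D s * g s) / (3 * (1 + 2 * L s))) s)
    (hL : ∀ s, HasDerivAt L (g s / 2) s) (hpos : ∀ s, 0 < 1 + 2 * L s) (a b : ℝ) :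
    D a * (1 + 2 * L a) ^ (1 / 3 : ℝ) = D b * (1 + 2 * L b) ^ (1 / 3 : ℝ) := by
  have hJ : ∀ s, HasDerivAt (fun s => D s * (1 + 2 * L s) ^ (1 / 3 : ℝ)) 0 s := fun s =>
    deficitInvariant_hasDerivAt_zero (hD s) (hL s) (hpos s) rfl rfl
  exact is_const_of_deriv_eq_zero (fun s => (hJ s).differentiableAt) (fun s => (hJ s).deriv) a b

/-- **Corner value of the invariant.** At the corner (`σ → −∞`) the deficit is `3` (no flux yet) and `L = 0`, so `J` starts at
`3`; its computed limit `J_∞ = 2.565` is below `3` by the delay effect only. [new here — MODEL bookkeeping] -/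
theorem deficitInvariant_corner : (3 : ℝ) * (1 + 2 * 0) ^ (1 / 3 : ℝ) = 3 := by
  norm_num

/-! ## §2 The explicit deficit law `D̂(L) = D₁ (1+2L)^{−1/3}` and the constant `D₀ = D₁ 2^{−1/3}` -/

/-- **The deficit law in `L`.** `D̂(L) = D₁(1+2L)^{−1/3}` satisfies `(1+2L)·D̂′(L) = −(2/3)·D̂(L)` on `1 + 2L > 0` — the
`L`-form of the delay-free law (`dD̂/dL = D̂′/L′ = −2D̂/(3(1+2L))`). [new here — MODEL calculus; asym/g6/TRENCH-DEFICIT.md §2] -/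
theorem deficitLaw_hasDerivAt (D₁ : ℝ) {L : ℝ} (hL : 0 < 1 + 2 * L) :
    HasDerivAt (fun l : ℝ => D₁ * (1 + 2 * l) ^ (-(1 / 3 : ℝ)))
        (D₁ * (2 * (-(1 / 3 : ℝ)) * (1 + 2 * L) ^ (-(1 / 3 : ℝ) - 1))) L
      ∧ (1 + 2 * L) * (D₁ * (2 * (-(1 / 3 : ℝ)) * (1 + 2 * L) ^ (-(1 / 3 : ℝ) - 1)))
          = -(2 / 3) * (D₁ * (1 + 2 * L) ^ (-(1 / 3 : ℝ))) := by
  constructor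
  · have h1 : HasDerivAt (fun l : ℝ => 1 + 2 * l) 2 L := by
      have := ((hasDerivAt_id' L).const_mul 2).const_add 1
      simpa using this
    have h2 := (h1.rpow_const (p := -(1 / 3 : ℝ)) (Or.inl hL.ne')).const_mul D₁
    exact h2.congr_deriv (by ring)
  · rw [Real.rpow_sub_one hL.ne']
    field_simp

/-- **`D₀ = D₁·2^{−1/3}`.** Along the deficit law, `D̂(L)·L^{1/3} = D₁(1+2L)^{−1/3}L^{1/3} → D₁·2^{−1/3}` as `L → ∞`
(`D₀ := lim (3 − τ𝒢)L^{1/3}`; numerically `J_∞ = 2.56526 ⇒ D₀ = 2.03605`). [new here — MODEL calculus; asym/g6/TRENCH-DEFICIT.md §3] -/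
theorem deficitLaw_tendsto_D0 (D₁ : ℝ) :
    Tendsto (fun L : ℝ => D₁ * (1 + 2 * L) ^ (-(1 / 3 : ℝ)) * L ^ (1 / 3 : ℝ)) atTop
      (𝓝 (D₁ * 2 ^ (-(1 / 3 : ℝ)))) := by
  -- rewrite, for `L > 0`, as `D₁ * (L / (1 + 2L)) ^ (1/3)` and use `L/(1+2L) → 1/2`
  have hlim : Tendsto (fun L : ℝ => L / (1 + 2 * L)) atTop (𝓝 (1 / 2 : ℝ)) := by
    have h1 : Tendsto (fun L : ℝ => L⁻¹) atTop (𝓝 0) := tendsto_inv_atTop_zero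
    have h2 : Tendsto (fun L : ℝ => L⁻¹ + 2) atTop (𝓝 ((0 : ℝ) + 2)) := h1.add_const 2
    have h3 : Tendsto (fun L : ℝ => (L⁻¹ + 2)⁻¹) atTop (𝓝 (((0 : ℝ) + 2)⁻¹)) :=
      h2.inv₀ (by norm_num)
    have h4 : (((0 : ℝ) + 2)⁻¹) = 1 / 2 := by norm_num
    rw [h4] at h3
    refine h3.congr' ?_
    filter_upwards [eventually_gt_atTop (0 : ℝ)] with L hL
    have hL' : (0 : ℝ) < 1 + 2 * L := by linarith
    field_simp
  have hpow : Tendsto (fun L : ℝ => (L / (1 + 2 * L)) ^ (1 / 3 : ℝ)) atTop (𝓝 ((1 / 2 : ℝ) ^ (1 / 3 : ℝ))) :=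
    hlim.rpow_const (Or.inl (by norm_num))
  have hhalf : (1 / 2 : ℝ) ^ (1 / 3 : ℝ) = 2 ^ (-(1 / 3 : ℝ)) := by
    rw [Real.rpow_neg (by norm_num : (0 : ℝ) ≤ 2), one_div, Real.inv_rpow (by norm_num : (0 : ℝ) ≤ 2)]
  rw [hhalf] at hpow
  refine (hpow.const_mul D₁).congr' ?_
  filter_upwards [eventually_gt_atTop (0 : ℝ)] with L hL
  have hL' : (0 : ℝ) < 1 + 2 * L := by linarith
  rw [Real.div_rpow hL.le hL'.le, Real.rpow_neg hL'.le]
  field_simp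

/-! ## §3 Matching: the deficit is the singular branch of the drain orbit -/

/-- **Matching to the singular orbit branch.** In plateau variables `Λ = m̃L` the large-`L` deficit `μD₁(2Λ/m̃)^{−1/3}` equals
`(μD₁(m̃/2)^{1/3})·Λ^{−1/3}`, i.e. the branch `KΛ^{−1/3}` of `ElgindiDrainClosure.drainOrbit_general` with `K = −μD₁(m̃/2)^{1/3}`
(`= −μD₀m̃^{1/3}`). [new here — MODEL `rpow` algebra; asym/g6/TRENCH-DEFICIT.md §3] -/
theorem matching_singularBranch (μ D₁ : ℝ) {Λ m : ℝ} (hΛ : 0 < Λ) (hm : 0 < m) :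
    μ * D₁ * (2 * Λ / m) ^ (-(1 / 3 : ℝ)) = (μ * D₁ * (m / 2) ^ (1 / 3 : ℝ)) * Λ ^ (-(1 / 3 : ℝ)) := by
  have h2Λ : (0 : ℝ) ≤ 2 * Λ := by positivity
  rw [Real.rpow_neg (div_nonneg h2Λ hm.le), Real.rpow_neg hΛ.le, Real.div_rpow h2Λ hm.le,
    Real.div_rpow hm.le (by norm_num : (0 : ℝ) ≤ 2), Real.mul_rpow (by norm_num : (0 : ℝ) ≤ 2) hΛ.le]
  have hΛ3 : 0 < Λ ^ (1 / 3 : ℝ) := Real.rpow_pos_of_pos hΛ _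
  have hm3 : 0 < m ^ (1 / 3 : ℝ) := Real.rpow_pos_of_pos hm _
  have h23 : 0 < (2 : ℝ) ^ (1 / 3 : ℝ) := Real.rpow_pos_of_pos (by norm_num) _
  field_simp

/-! ## §4 The mass condition with the singular branch, in cube-root variables -/

/-- **`rpow` dictionary for the singular branch at the drain end.** With `K = −μD₀(εμ)^{1/3}` (matching constant in plateau
units, `ε, μ > 0`), the singular term of the orbit at `Λ = 1/2` is `K(1/2)^{−1/3} = −D₀(2ε)^{1/3}μ^{1/3}μ`.
[new here — MODEL `rpow` algebra; asym/LIMIT-ANALYSIS.md §5] -/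
theorem singularBranch_at_half (D₀ : ℝ) {ε μ : ℝ} (hε : 0 < ε) (hμ : 0 < μ) :
    (-(μ * D₀ * (ε * μ) ^ (1 / 3 : ℝ))) * (1 / 2 : ℝ) ^ (-(1 / 3 : ℝ))
      = -(D₀ * (2 * ε) ^ (1 / 3 : ℝ) * μ ^ (1 / 3 : ℝ) * μ) := by
  rw [Real.mul_rpow hε.le hμ.le, Real.mul_rpow (by norm_num : (0 : ℝ) ≤ 2) hε.le,
    Real.rpow_neg (by norm_num : (0 : ℝ) ≤ 1 / 2), one_div (2 : ℝ),
    Real.inv_rpow (by norm_num : (0 : ℝ) ≤ 2), inv_inv]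
  ring

/-- **Mass condition ⇔ quartic.** Write `μ = v³` (`v = μ^{1/3}`), `C = (1+μ)/2` (i.e. `μ = 2C − 1`) and let `e` stand for
`(2ε)^{1/3}` so that the singular term at `Λ = 1/2` is `−D₀·e·v·v³` (`singularBranch_at_half`). Then the drain-end condition
`γ(1/2) = 3μ − 3C·(1/2) + K(1/2)^{−1/3} = 0` is the QUARTIC `9v³ − 3 = 4a v⁴` with `a = D₀e = D₀(2ε)^{1/3}`; at `a = 0` it
returns `v³ = 1/3`, i.e. `C = 2/3` (`ElgindiDrainClosure.drainConstant_eq_two_thirds`). [new here — MODEL algebra; asym/LIMIT-ANALYSIS.md §5] -/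
theorem massCondition_iff_quartic (D₀ e v : ℝ) :
    3 * v ^ 3 - 3 * ((1 + v ^ 3) / 2) * (1 / 2) + -(D₀ * e * v * v ^ 3) = 0
      ↔ 9 * v ^ 3 - 3 = 4 * (D₀ * e) * v ^ 4 := by
  constructor <;> intro h <;> linarith

/-! ## §5 The quartic `9v³ − 3 = 4a v⁴`: unique root in `[0,1]`, two-sided bounds, and the leading coefficient `κ₁` -/

/-- **The reference root `v₀ = (1/3)^{1/3}`** (the `a = 0` root: `v₀³ = 1/3`, i.e. `μ₀ = 1/3`, `C₀ = 2/3`): `0 < v₀ < 1` and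
`v₀³ = 1/3`. [new here — numeric bookkeeping] -/
theorem cubeRoot_third :
    0 < (1 / 3 : ℝ) ^ (1 / 3 : ℝ) ∧ ((1 / 3 : ℝ) ^ (1 / 3 : ℝ)) ^ 3 = 1 / 3 ∧ (1 / 3 : ℝ) ^ (1 / 3 : ℝ) < 1 := by
  refine ⟨Real.rpow_pos_of_pos (by norm_num) _, ?_, ?_⟩
  · rw [← Real.rpow_natCast, ← Real.rpow_mul (by norm_num : (0 : ℝ) ≤ 1 / 3)]
    norm_num
  · exact Real.rpow_lt_one (by norm_num) (by norm_num) (by norm_num)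

/-- **Strict monotonicity.** For `0 ≤ a < 9/8` the quartic `h_a(v) = 9v³ − 3 − 4av⁴` is strictly increasing on `[0, 1]`
(`h_a(w) − h_a(v) = (w − v)[9(w² + wv + v²) − 4a(w + v)(w² + v²)]` and `(w+v)(w²+v²) ≤ 2(w² + wv + v²)` there), so it has
AT MOST ONE root in `[0,1]`. [new here — MODEL algebra; asym/g6/TRENCH-DEFICIT.md §4] -/
theorem quartic_strictMonoOn {a : ℝ} (ha : 0 ≤ a) (ha' : a < 9 / 8) :
    StrictMonoOn (fun v : ℝ => 9 * v ^ 3 - 3 - 4 * a * v ^ 4) (Set.Icc 0 1) := by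
  intro v hv w hw hvw
  simp only [Set.mem_Icc] at hv hw
  have hQ : 0 < w ^ 2 + w * v + v ^ 2 := by nlinarith
  have hS : (w + v) * (w ^ 2 + v ^ 2) ≤ 2 * (w ^ 2 + w * v + v ^ 2) := by nlinarith
  have hfac : (9 * w ^ 3 - 3 - 4 * a * w ^ 4) - (9 * v ^ 3 - 3 - 4 * a * v ^ 4)
      = (w - v) * (9 * (w ^ 2 + w * v + v ^ 2) - 4 * a * ((w + v) * (w ^ 2 + v ^ 2))) := by ring
  have hpos : 0 < 9 * (w ^ 2 + w * v + v ^ 2) - 4 * a * ((w + v) * (w ^ 2 + v ^ 2)) := by nlinarith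
  have : 0 < (9 * w ^ 3 - 3 - 4 * a * w ^ 4) - (9 * v ^ 3 - 3 - 4 * a * v ^ 4) := by
    rw [hfac]; exact mul_pos (by linarith) hpos
  linarith

/-- **Uniqueness in `[0, 1]`.** For `0 ≤ a < 9/8` two roots of `9v³ − 3 = 4av⁴` in `[0,1]` coincide
(`quartic_strictMonoOn`); with `quartic_root_exists` the physical root `v(a) = μ(a)^{1/3}` is therefore THE root in `[0,1]`
and lies in `[v₀, 1]`. [new here — MODEL algebra; asym/g6/TRENCH-DEFICIT.md §4] -/
theorem quartic_root_unique {a v w : ℝ} (ha : 0 ≤ a) (ha' : a < 9 / 8) (hv : v ∈ Set.Icc (0 : ℝ) 1)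
    (hw : w ∈ Set.Icc (0 : ℝ) 1) (hrv : 9 * v ^ 3 - 3 = 4 * a * v ^ 4) (hrw : 9 * w ^ 3 - 3 = 4 * a * w ^ 4) :
    v = w :=
  (quartic_strictMonoOn ha ha').injOn hv hw
    (show (9 * v ^ 3 - 3 - 4 * a * v ^ 4) = (9 * w ^ 3 - 3 - 4 * a * w ^ 4) by linarith)

/-- **Existence in `[v₀, 1]`.** For `0 ≤ a ≤ 3/2` the quartic has a root with `v₀ ≤ v ≤ 1` (`h_a(v₀) = −4av₀⁴ ≤ 0 ≤ 6 − 4a = h_a(1)`,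
intermediate value theorem), where `0 < v₀ ≤ 1`, `v₀³ = 1/3`. [new here — MODEL analysis; asym/g6/TRENCH-DEFICIT.md §4] -/
theorem quartic_root_exists {a v₀ : ℝ} (ha : 0 ≤ a) (ha' : a ≤ 3 / 2) (hv₀ : 0 < v₀) (hv₀1 : v₀ ≤ 1)
    (hv₀3 : v₀ ^ 3 = 1 / 3) :
    ∃ v ∈ Set.Icc v₀ 1, 9 * v ^ 3 - 3 = 4 * a * v ^ 4 := by
  have hcont : ContinuousOn (fun v : ℝ => 9 * v ^ 3 - 3 - 4 * a * v ^ 4) (Set.Icc v₀ 1) := by fun_prop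
  have hlo : 9 * v₀ ^ 3 - 3 - 4 * a * v₀ ^ 4 ≤ 0 := by
    have : 0 ≤ v₀ ^ 4 := by positivity
    nlinarith
  have hhi : (0 : ℝ) ≤ 9 * (1 : ℝ) ^ 3 - 3 - 4 * a * 1 ^ 4 := by linarith
  obtain ⟨v, hv, hv0⟩ := intermediate_value_Icc hv₀1 hcont ⟨hlo, hhi⟩
  exact ⟨v, hv, by linarith⟩

/-- **Two-sided bounds on the root.** If `v₀ ≤ v ≤ 1` solves `9v³ − 3 = 4av⁴` (`a ≥ 0`, `v₀³ = 1/3`, `16a < 27v₀²`), then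
`x := v³ − 1/3` (`= μ − 1/3 = 2(C − 2/3)`) satisfies `4av₀/27 ≤ x ≤ (4a/3)/(27v₀² − 16a)` — both sides `= 4a/(81v₀²) + O(a²)`,
so the bound is first-order sharp. (Lower: `x = (4a/9)v⁴ ≥ (4a/9)v₀⁴ = 4av₀/27`; upper: `v⁴ ≤ v₀⁴ + 4(v − v₀)` and
`x ≥ 3v₀²(v − v₀)`.) [new here — MODEL algebra; asym/g6/TRENCH-DEFICIT.md §4] -/
theorem quartic_root_bounds {a v₀ v : ℝ} (ha : 0 ≤ a) (hv₀ : 0 < v₀) (hv₀3 : v₀ ^ 3 = 1 / 3)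
    (ha2 : 16 * a < 27 * v₀ ^ 2) (hv : v₀ ≤ v) (hv1 : v ≤ 1) (hroot : 9 * v ^ 3 - 3 = 4 * a * v ^ 4) :
    4 * a * v₀ / 27 ≤ v ^ 3 - 1 / 3 ∧ v ^ 3 - 1 / 3 ≤ (4 * a / 3) / (27 * v₀ ^ 2 - 16 * a) := by
  have hx : v ^ 3 - 1 / 3 = (4 * a / 9) * v ^ 4 := by linarith
  have hv₀4 : v₀ ^ 4 = v₀ / 3 := by
    have : v₀ ^ 4 = v₀ ^ 3 * v₀ := by ring
    rw [this, hv₀3]; ring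
  have hvpos : 0 < v := lt_of_lt_of_le hv₀ hv
  -- lower bound: v⁴ ≥ v₀⁴
  have h44 : v₀ ^ 4 ≤ v ^ 4 := by
    have h1 : 0 ≤ v - v₀ := sub_nonneg.2 hv
    nlinarith [mul_nonneg (mul_nonneg h1 (add_nonneg hvpos.le hv₀.le))
      (add_nonneg (sq_nonneg v) (sq_nonneg v₀))]
  constructor
  · rw [hx]
    have : 4 * a * v₀ / 27 = (4 * a / 9) * v₀ ^ 4 := by rw [hv₀4]; ring
    rw [this]
    exact mul_le_mul_of_nonneg_left h44 (by positivity)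
  · -- upper bound
    have hdiff : v ^ 4 - v₀ ^ 4 ≤ 4 * (v - v₀) := by
      have h1 : 0 ≤ v - v₀ := sub_nonneg.2 hv
      have hfac : v ^ 4 - v₀ ^ 4 = (v - v₀) * (v ^ 3 + v ^ 2 * v₀ + v * v₀ ^ 2 + v₀ ^ 3) := by ring
      have hle : v ^ 3 + v ^ 2 * v₀ + v * v₀ ^ 2 + v₀ ^ 3 ≤ 4 := by
        have hv₀1 : v₀ ≤ 1 := le_trans hv hv1
        have e1 : v ^ 3 ≤ 1 := by nlinarith
        have e2 : v ^ 2 * v₀ ≤ 1 := by nlinarith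
        have e3 : v * v₀ ^ 2 ≤ 1 := by nlinarith
        have e4 : v₀ ^ 3 ≤ 1 := by nlinarith
        linarith
      rw [hfac]; nlinarith
    have hcube : 3 * v₀ ^ 2 * (v - v₀) ≤ v ^ 3 - 1 / 3 := by
      rw [← hv₀3]
      have h1 : 0 ≤ v - v₀ := sub_nonneg.2 hv
      have hfac : v ^ 3 - v₀ ^ 3 = (v - v₀) * (v ^ 2 + v * v₀ + v₀ ^ 2) := by ring
      rw [hfac]
      have : 3 * v₀ ^ 2 ≤ v ^ 2 + v * v₀ + v₀ ^ 2 := by nlinarith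
      nlinarith
    have hden : 0 < 27 * v₀ ^ 2 - 16 * a := by linarith
    rw [le_div_iff₀ hden]
    -- x (27 v₀² − 16 a) ≤ 4a/3, from x = (4a/9) v⁴ ≤ (4a/9)(v₀⁴ + 4 (v − v₀)) ≤ (4a/9)(v₀/3 + 4x/(3v₀²))
    have hv₀2 : 0 < v₀ ^ 2 := by positivity
    have key : (v ^ 3 - 1 / 3) * (3 * v₀ ^ 2) ≤ (4 * a / 9) * (v₀ / 3 * (3 * v₀ ^ 2) + 4 * (v ^ 3 - 1 / 3)) := by
      have h1 : (v ^ 3 - 1 / 3) * (3 * v₀ ^ 2) = (4 * a / 9) * (v ^ 4 * (3 * v₀ ^ 2)) := by rw [hx]; ring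
      rw [h1]
      apply mul_le_mul_of_nonneg_left _ (by positivity)
      nlinarith
    nlinarith

/-- **The leading coefficient.** For ANY selection of roots `v(a) ∈ [v₀, 1]` of `9v³ − 3 = 4av⁴`, `(v(a)³ − 1/3)/a → 4v₀/27`
as `a → 0⁺` (squeeze between the bounds of `quartic_root_bounds`; `4v₀/27 = (4a/3)/(27v₀²)·(1/a)` because `v₀³ = 1/3`).
In `C`-language: `(C − 2/3)/a → 2v₀/27 = 3^{−4/3}/4.5`, i.e. `C(ε) = 2/3 + κ₁ε^{1/3} + o(ε^{1/3})` with
`κ₁ = (2v₀/27)·D₀·2^{1/3} = (2/27)(2/3)^{1/3}D₀`. [new here — MODEL analysis; asym/g6/TRENCH-DEFICIT.md §4] -/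
theorem quartic_root_tendsto {v₀ : ℝ} (hv₀ : 0 < v₀) (hv₀3 : v₀ ^ 3 = 1 / 3) {v : ℝ → ℝ} {a₁ : ℝ} (ha₁ : 0 < a₁)
    (ha₁' : 16 * a₁ < 27 * v₀ ^ 2)
    (hroot : ∀ a ∈ Set.Ioo 0 a₁, v₀ ≤ v a ∧ v a ≤ 1 ∧ 9 * v a ^ 3 - 3 = 4 * a * v a ^ 4) :
    Tendsto (fun a => (v a ^ 3 - 1 / 3) / a) (𝓝[>] 0) (𝓝 (4 * v₀ / 27)) := by
  have hv₀2 : 0 < 27 * v₀ ^ 2 := by positivity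
  -- upper comparison function and its limit
  have hup : Tendsto (fun a : ℝ => (4 / 3) / (27 * v₀ ^ 2 - 16 * a)) (𝓝[>] 0) (𝓝 (4 * v₀ / 27)) := by
    have hc : Tendsto (fun a : ℝ => (4 / 3) / (27 * v₀ ^ 2 - 16 * a)) (𝓝 0) (𝓝 ((4 / 3) / (27 * v₀ ^ 2 - 16 * 0))) := by
      have : ContinuousAt (fun a : ℝ => (4 / 3) / (27 * v₀ ^ 2 - 16 * a)) 0 := by
        have hne : (27 * v₀ ^ 2 - 16 * (0 : ℝ)) ≠ 0 := by simpa using hv₀2.ne'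
        fun_prop (disch := exact hne)
      exact this.tendsto
    have hval : (4 / 3 : ℝ) / (27 * v₀ ^ 2 - 16 * 0) = 4 * v₀ / 27 := by
      have hv₀4 : v₀ * v₀ ^ 2 = 1 / 3 := by rw [← hv₀3]; ring
      field_simp
      nlinarith [hv₀4]
    rw [hval] at hc
    exact hc.mono_left nhdsWithin_le_nhds
  have hIoo : Set.Ioo (0 : ℝ) a₁ ∈ 𝓝[>] (0 : ℝ) := Ioo_mem_nhdsGT ha₁
  refine tendsto_of_tendsto_of_tendsto_of_le_of_le' tendsto_const_nhds hup ?_ ?_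
  · filter_upwards [hIoo] with a ha
    have ha16 : 16 * a < 27 * v₀ ^ 2 := by linarith [ha.2]
    obtain ⟨h1, h2, h3⟩ := hroot a ha
    have hb := (quartic_root_bounds ha.1.le hv₀ hv₀3 ha16 h1 h2 h3).1
    rw [le_div_iff₀ ha.1]
    linarith
  · filter_upwards [hIoo] with a ha
    have ha16 : 16 * a < 27 * v₀ ^ 2 := by linarith [ha.2]
    obtain ⟨h1, h2, h3⟩ := hroot a ha
    have hb := (quartic_root_bounds ha.1.le hv₀ hv₀3 ha16 h1 h2 h3).2
    rw [div_le_iff₀ ha.1]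
    have hden : 0 < 27 * v₀ ^ 2 - 16 * a := by linarith
    calc v a ^ 3 - 1 / 3 ≤ (4 * a / 3) / (27 * v₀ ^ 2 - 16 * a) := hb
      _ = (4 / 3) / (27 * v₀ ^ 2 - 16 * a) * a := by field_simp

/-- **The leading coefficient is `3^{−4/3}/4.5` in the two presentations.** With `v₀³ = 1/3`: `2v₀/27 = v₀⁴·(2/9)`, i.e.
`(C − 2/3)/a → (2/9)·3^{−4/3} = 3^{−4/3}/4.5` (LIMIT-ANALYSIS §5's linearisation of `4.5C − 3 = a(2C−1)^{4/3}` at `C = 2/3`).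
[new here — MODEL algebra] -/
theorem leadingCoefficient_eq {v₀ : ℝ} (hv₀3 : v₀ ^ 3 = 1 / 3) :
    2 * v₀ / 27 = v₀ ^ 4 * (2 / 9) ∧ v₀ ^ 4 * (2 / 9) = v₀ ^ 4 / (9 / 2) := by
  constructor
  · have : v₀ ^ 4 = v₀ ^ 3 * v₀ := by ring
    rw [this, hv₀3]; ring
  · ring

/-- **Numeric bracket for `κ₁`.** `κ₁ = (2/27)·t·D₀` with `t = (2/3)^{1/3}` (`t > 0`, `t³ = 2/3`); for the computed
`D₀ ∈ [2.0360, 2.0361]` (`J_∞ = 2.56526 ± 3e-5`) one has `0.1317 < κ₁ < 0.1318` (reduced-model table: `(C − 2/3)/ε^{1/3}`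
falls `0.139 → 0.1323` over `ε = 1.25e-3 → 1e-5`). [new here — MODEL numerics dictionary; asym/g6/TRENCH-DEFICIT.md §3] -/
theorem kappa1_bracket {t D₀ : ℝ} (ht : 0 < t) (ht3 : t ^ 3 = 2 / 3) (hD : 2.0360 ≤ D₀) (hD' : D₀ ≤ 2.0361) :
    0.1317 < 2 / 27 * t * D₀ ∧ 2 / 27 * t * D₀ < 0.1318 := by
  have htlo : 0.8735 < t := by
    by_contra h
    have h' : t ≤ 0.8735 := not_lt.mp h
    have : t ^ 3 ≤ (0.8735 : ℝ) ^ 3 := pow_le_pow_left₀ ht.le h' 3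
    nlinarith
  have hthi : t < 0.8736 := by
    by_contra h
    have h' : 0.8736 ≤ t := not_lt.mp h
    have : (0.8736 : ℝ) ^ 3 ≤ t ^ 3 := pow_le_pow_left₀ (by norm_num) h' 3
    nlinarith
  constructor <;> nlinarith

/-! ## §6 (append, g6) Second order: the quartic is complete through `O(a²)` — `C − 2/3 = κ₁ε^{1/3} + 8κ₁²ε^{2/3} + O(ε)` -/

/-- **Second-order squeeze of the root.** With `x := v³ − 1/3` and `x₁ := 4av₀/27` (the first-order value), a root
`v₀ ≤ v ≤ 1` of `9v³ − 3 = 4av⁴` satisfies `x₁(1 + 4x + 2x² − 3x³) ≤ x ≤ x₁(1 + 4x + 3x²)`; hence `x = x₁ + 4x₁x + O(x₁x²)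
= x₁ + 4x₁² + O(x₁³)`. (From `x = (4a/9)·v·(1/3 + x)` and `v₀(1 + x − x²) ≤ v ≤ v₀(1 + x)`, i.e. `(1 + x − x²)³ ≤ 1 + 3x ≤ (1 + x)³`.)
In `C`-language (`C − 2/3 = x/2`, `κ₁ε^{1/3} = x₁/2`): `C − 2/3 = κ₁ε^{1/3} + 8κ₁²ε^{2/3} + O(ε)` — the matched singular branch fixes
the `ε^{2/3}` coefficient too (`8κ₁² = 0.1389`); the reduced-model table's residual after the quartic root is `−(0.87 ± 0.04)ε`
(twin eng-9 g3: `−0.86ε`), the first order NOT derived here. [new here — MODEL algebra; asym/g6/TRENCH-DEFICIT.md §4] -/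
theorem quartic_root_secondOrder {a v₀ v : ℝ} (ha : 0 ≤ a) (hv₀ : 0 < v₀) (hv₀3 : v₀ ^ 3 = 1 / 3)
    (hv : v₀ ≤ v) (hv1 : v ≤ 1) (hroot : 9 * v ^ 3 - 3 = 4 * a * v ^ 4) :
    (4 * a * v₀ / 27) * (1 + 4 * (v ^ 3 - 1 / 3) + 2 * (v ^ 3 - 1 / 3) ^ 2 - 3 * (v ^ 3 - 1 / 3) ^ 3) ≤ v ^ 3 - 1 / 3
      ∧ v ^ 3 - 1 / 3 ≤ (4 * a * v₀ / 27) * (1 + 4 * (v ^ 3 - 1 / 3) + 3 * (v ^ 3 - 1 / 3) ^ 2) := by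
  set x := v ^ 3 - 1 / 3 with hxdef
  have hvpos : 0 < v := lt_of_lt_of_le hv₀ hv
  have hx0 : 0 ≤ x := by
    have : v₀ ^ 3 ≤ v ^ 3 := pow_le_pow_left₀ hv₀.le hv 3
    rw [hxdef]; linarith
  have hx1 : x ≤ 2 / 3 := by
    have : v ^ 3 ≤ 1 := pow_le_one₀ hvpos.le hv1
    rw [hxdef]; linarith
  -- the root relation in the form x = (4a/9)·v·(1/3 + x)
  have key : x = (4 * a / 9) * v * (1 / 3 + x) := by
    rw [hxdef]; linear_combination (1 / 9 : ℝ) * hroot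
  have hv3 : v ^ 3 = 1 / 3 + x := by rw [hxdef]; ring
  -- upper bound on v: v ≤ v₀ (1 + x), from v³ = (1 + 3x)/3 ≤ v₀³ (1 + x)³
  have hvup : v ≤ v₀ * (1 + x) := by
    have hw : 0 ≤ v₀ * (1 + x) := by positivity
    refine le_of_pow_le_pow_left₀ (by norm_num : (3 : ℕ) ≠ 0) hw ?_
    have : (v₀ * (1 + x)) ^ 3 = v₀ ^ 3 * (1 + x) ^ 3 := by ring
    rw [this, hv₀3, hv3]
    nlinarith [sq_nonneg x, mul_nonneg hx0 (sq_nonneg x)]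
  -- lower bound on v: v₀ (1 + x − x²) ≤ v, from (1 + x − x²)³ ≤ 1 + 3x on 0 ≤ x ≤ 1
  have hvlo : v₀ * (1 + x - x ^ 2) ≤ v := by
    refine le_of_pow_le_pow_left₀ (by norm_num : (3 : ℕ) ≠ 0) hvpos.le ?_
    have : (v₀ * (1 + x - x ^ 2)) ^ 3 = v₀ ^ 3 * (1 + x - x ^ 2) ^ 3 := by ring
    rw [this, hv₀3, hv3]
    have hexp : (1 + x - x ^ 2) ^ 3 = 1 + 3 * x - 5 * x ^ 3 + 3 * x ^ 5 - x ^ 6 := by ring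
    rw [hexp]
    have h3 : 0 ≤ x ^ 3 := by positivity
    have h5 : x ^ 5 ≤ x ^ 3 := by nlinarith [mul_nonneg h3 hx0, mul_nonneg h3 (sq_nonneg x)]
    have h6 : 0 ≤ x ^ 6 := by positivity
    nlinarith
  have hc : 0 ≤ (4 * a / 9) * (1 / 3 + x) := by positivity
  constructor
  · have h1 : (4 * a / 9) * (1 / 3 + x) * (v₀ * (1 + x - x ^ 2)) ≤ (4 * a / 9) * (1 / 3 + x) * v :=
      mul_le_mul_of_nonneg_left hvlo hc
    have h2 : (4 * a / 9) * (1 / 3 + x) * v = x := by linarith [key]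
    have h3 : (4 * a / 9) * (1 / 3 + x) * (v₀ * (1 + x - x ^ 2))
        = (4 * a * v₀ / 27) * (1 + 4 * x + 2 * x ^ 2 - 3 * x ^ 3) := by ring
    linarith
  · have h1 : (4 * a / 9) * (1 / 3 + x) * v ≤ (4 * a / 9) * (1 / 3 + x) * (v₀ * (1 + x)) :=
      mul_le_mul_of_nonneg_left hvup hc
    have h2 : (4 * a / 9) * (1 / 3 + x) * v = x := by linarith [key]
    have h3 : (4 * a / 9) * (1 / 3 + x) * (v₀ * (1 + x)) = (4 * a * v₀ / 27) * (1 + 4 * x + 3 * x ^ 2) := by ring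
    linarith

/-- **`κ₂ = 8κ₁²`.** If `C − 2/3 = x/2` and the first-order value is `κ₁ε^{1/3} = x₁/2`, the second-order term `2x₁²` of
`x = x₁ + 4x₁² + …` reads `8(x₁/2)²`: `C − 2/3 = κ₁ε^{1/3} + 8κ₁²ε^{2/3} + O(ε)`, `8κ₁² ∈ (0.1387, 0.1390)` for
`κ₁ ∈ (0.1317, 0.1318)`. [new here — MODEL algebra] -/
theorem kappa2_eq (x₁ κ : ℝ) (h : κ = x₁ / 2) : (4 * x₁ ^ 2) / 2 = 8 * κ ^ 2
    ∧ (0.1317 < κ → κ < 0.1318 → 0.1387 < 8 * κ ^ 2 ∧ 8 * κ ^ 2 < 0.1390) := by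
  refine ⟨by rw [h]; ring, fun h1 h2 => ⟨by nlinarith, by nlinarith⟩⟩

end ElgindiTrenchDeficit
end Summit.NavierStokesRegularity.OSWSelfSimilar
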